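import Summits.FinalStateConjecture.FinalStateConjecture.Theorems.RenormalisedDriftDriftCaptureOrthochronousRelabel
import HarnessLib

/-!
# GLUING stub `stub_lateChartsOfSharpChain` of crux `DriftCapture` (stmt-FinalStateConjecture-17391),
# line `registered` (skeleton v6/v7): the honest-radius FLOOR of its conclusion is free

The registered stub `stub_lateChartsOfSharpChain` of
`Summits/FinalStateConjecture/FinalStateConjecture/Cruxes/DriftCapture/Lines/birth.lean` (ASSEMBLE's gluing
content on the live range `0 < N`, `m₀ ≤ 1`: ONE sharpening chain of `εₙ`-approximate `N`-Kerr configurations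
on chart-time windows `[0, 1]`, eventually pinned at `(M, a, Λ)`, ⇒ `N + 1` late charts with the twelve
packaging clauses of `decomposition_of_unorientedLateCharts`, p156248) is research-level (near-isometry
rigidity of truncated Kerr / flat slabs, causal geometry of window images, patching; no tree API). This file
lands one more piece of it that is bookkeeping.

Clause 8 of the packaging asks for HONEST GROWING near-zone radii: `Rᵢ → ∞` AND the floor
`Rᵢ(τ) ≥ max(r₊(Mᵢ, aᵢ), 0) + 1` for EVERY chart time `τ` (so that no truncated slab `{t*ᵢ = τ, rᵢ ≤ Rᵢ(τ)}`
is empty; audit 2026-08-16 (B) of the summit statement). The floor is free: given radii `Rᵢ → ∞` for which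
the near-zone `C²` deviation out to `Rᵢ(τ)` tends to `0` (clause 9) and the certified causal covering holds
(clause 10), the radii `R'ᵢ(τ) := max (Rᵢ τ) (max (r₊) 0 + 1)` satisfy all three clauses — clause 8 by
construction, clause 9 because `R'ᵢ = Rᵢ` EVENTUALLY (`Rᵢ → ∞` passes the floor) and a limit only sees the
tail, clause 10 because it is MONOTONE in the radii (a larger radius certifies more, so the uncertified part
of `O'` shrinks, and the certified slab, hence its causal past, grows: `truncTimeSlab_mono`,
`causalFuture_mono`).

* `lateCharts_honestRadii` — the three `R`-clauses with the floor deleted ⇒ the three `R`-clauses, same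
  other data;
* `decomposition_of_unflooredLateCharts` — `decomposition_of_unorientedLateCharts` (p156248) with clause 8
  weakened to `∀ i, Tendsto (R i) atTop atTop` (registered sub-goal);
* `lateChartsOfSharpChain_of_unfloored` — the registered stub follows VERBATIM from the same statement with
  the floor deleted from its conclusion (so the floor-free gluing statement is an admissible replacement of
  the stub in the skeleton: the gluing may read its radii straight off the windows' `Rₙ → ∞`).

No definitions, no named facts, no `sorry`.

References: Dafermos–Holzegel–Rodnianski–Taylor arXiv:2104.08222, §1 (truncated slabs `{r ≤ R}` of the
`Cᵏ`-deviation gauge); Dafermos–Luk arXiv:1710.01722, Conjecture 1 (b)–(c); O'Neill 1983, Ch. 14, p. 402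
(`J⁻` is monotone).
-/

set_option linter.dupNamespace false

noncomputable section

namespace Summit.FinalStateConjecture.FinalStateConjecture.Theorems.RenormalisedDrift.DriftCapture

open Set Filter Topology
open scoped Manifold ContDiff ENNReal
open Literature.Geometry.Lorentzian

/-- **Honest radii: the floor is free.** Over a Cauchy development `𝒟`, let hole charts `Ψᵢ` on the boosted
Kerr exteriors `(Mᵢ, aᵢ, Λᵢ, cᵢ)`, a flat chart `Φ` on `U₀`, a region `O'`, a time `τ₀` and radii `Rᵢ → ∞` be
given such that the near-zone `C²` deviation of `Ψᵢ` out to `Rᵢ(τ)` tends to `0` and, for every `τ₁ ≥ τ₀`, the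
part of `O'` certified by neither `Φ{x⁰ > τ₁}` nor some `Ψᵢ{t*ᵢ > τ₁, rᵢ ≤ Rᵢ(t*ᵢ)}` lies in the causal past of
the certified slab at `τ₁`. Then the radii `R'ᵢ(τ) := max (Rᵢ τ) (max (r₊(Mᵢ, aᵢ)) 0 + 1)` are honest
(`R'ᵢ → ∞`, `R'ᵢ ≥ max(r₊, 0) + 1`) and satisfy the same two clauses: eventually `R'ᵢ = Rᵢ`, and the covering
clause is monotone in the radii. DHRT arXiv:2104.08222, §1; O'Neill 1983, Ch. 14, p. 402. [folklore] -/
theorem lateCharts_honestRadii {X : Type} [TopologicalSpace X] [ChartedSpace E3 X]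
    [IsManifold (𝓡 3) ((⊤ : ℕ∞) : WithTop ℕ∞) X] [ConnectedSpace X] {D : InitialDataSet (𝓡 3) X}
    (𝒟 : CauchyDevelopment D) (N : ℕ) (M a : Fin N → ℝ) (O' : Set 𝒟.carrier)
    (mo : Fin N → lorentzGroup × E4) (τ₀ : ℝ)
    (Ψ : ∀ i, boostedKerrExterior (mo i).1 (mo i).2 (M i) (a i) → 𝒟.carrier)
    (U₀ : TopologicalSpace.Opens E4) (Φ : U₀ → 𝒟.carrier) (R : Fin N → ℝ → ℝ)
    (hR : ∀ i, Tendsto (R i) atTop atTop)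
    (htrunc : ∀ i, Tendsto (fun τ ↦ 𝒟.toSpacetime.truncDeviationCk
      (boostedKerrBackground (mo i).1 (mo i).2 (M i) (a i)) (Ψ i) 2 (R i τ) τ) atTop (𝓝 0))
    (hcov : ∀ τ₁ : ℝ, τ₀ ≤ τ₁ → O' \ (Φ '' (Minkowski.backgroundOn U₀).lateRegion τ₁ ∪
      ⋃ i, Ψ i '' {x | τ₁ < (boostedKerrBackground (mo i).1 (mo i).2 (M i) (a i)).time x.1 ∧
        (boostedKerrBackground (mo i).1 (mo i).2 (M i) (a i)).radius x.1 ≤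
          R i ((boostedKerrBackground (mo i).1 (mo i).2 (M i) (a i)).time x.1)}) ⊆
      𝒟.metric.causalPast 𝒟.timeOrientation (Φ '' (Minkowski.backgroundOn U₀).timeSlab τ₁ ∪
        ⋃ i, Ψ i '' (boostedKerrBackground (mo i).1 (mo i).2 (M i) (a i)).truncTimeSlab (R i τ₁) τ₁)) :
    ∃ R' : Fin N → ℝ → ℝ,
      (∀ i, Tendsto (R' i) atTop atTop ∧ ∀ τ, max (Kerr.rPlus (M i) (a i)) 0 + 1 ≤ R' i τ) ∧
      (∀ i, Tendsto (fun τ ↦ 𝒟.toSpacetime.truncDeviationCk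
        (boostedKerrBackground (mo i).1 (mo i).2 (M i) (a i)) (Ψ i) 2 (R' i τ) τ) atTop (𝓝 0)) ∧
      (∀ τ₁ : ℝ, τ₀ ≤ τ₁ → O' \ (Φ '' (Minkowski.backgroundOn U₀).lateRegion τ₁ ∪
        ⋃ i, Ψ i '' {x | τ₁ < (boostedKerrBackground (mo i).1 (mo i).2 (M i) (a i)).time x.1 ∧
          (boostedKerrBackground (mo i).1 (mo i).2 (M i) (a i)).radius x.1 ≤
            R' i ((boostedKerrBackground (mo i).1 (mo i).2 (M i) (a i)).time x.1)}) ⊆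
        𝒟.metric.causalPast 𝒟.timeOrientation (Φ '' (Minkowski.backgroundOn U₀).timeSlab τ₁ ∪
          ⋃ i, Ψ i '' (boostedKerrBackground (mo i).1 (mo i).2 (M i) (a i)).truncTimeSlab
            (R' i τ₁) τ₁)) := by
  refine ⟨fun i τ ↦ max (R i τ) (max (Kerr.rPlus (M i) (a i)) 0 + 1),
    fun i ↦ ⟨tendsto_atTop_mono (fun τ ↦ le_max_left _ _) (hR i), fun τ ↦ le_max_right _ _⟩,
    fun i ↦ ?_, fun τ₁ hτ₁ ↦ ?_⟩
  · -- eventually `R' i τ = R i τ`, and a limit only sees the tail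
    have hev : ∀ᶠ τ in atTop, max (Kerr.rPlus (M i) (a i)) 0 + 1 ≤ R i τ :=
      (hR i).eventually_ge_atTop _
    refine (htrunc i).congr' (hev.mono fun τ hτ ↦ ?_)
    simp only [max_eq_left hτ]
  · -- the covering clause is monotone in the radii
    refine Subset.trans (sdiff_subset_sdiff_right (union_subset_union_right _
      (iUnion_mono fun i ↦ image_mono fun x hx ↦ ⟨hx.1, hx.2.trans (le_max_left _ _)⟩)))
      ((hcov τ₁ hτ₁).trans (LorentzianMetric.causalFuture_mono (union_subset_union_right _
        (iUnion_mono fun i ↦ image_mono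
          ((boostedKerrBackground (mo i).1 (mo i).2 (M i) (a i)).truncTimeSlab_mono
            (le_max_left _ _) τ₁)))))

/-- **`N + 1` late charts package into an honest oriented decomposition — honest-radius floor not
required.** The landed `decomposition_of_unorientedLateCharts` (p156248: the twelve packaging clauses ⇒ a
`C²` `FinalStateDecomposition d` with `d.N = N`, labels `(M, a)`, `O' = exteriorOf 𝒟 d.charted`,
`HasExhaustiveCharts d`, `IsFutureOriented d`) with its clause 8 weakened from "`Rᵢ → ∞` and
`Rᵢ(τ) ≥ max(r₊, 0) + 1` for all `τ`" to `Rᵢ → ∞` alone: the floor is manufactured by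
`lateCharts_honestRadii` (enlarge the radii to the floor; clause 9 survives because the radii are unchanged
eventually, clause 10 because it is monotone in the radii). Dafermos–Luk arXiv:1710.01722,
Conjecture 1 (b)–(c); DHRT arXiv:2104.08222, §1. [folklore] -/
theorem decomposition_of_unflooredLateCharts : ∀ {X : Type} [TopologicalSpace X] [ChartedSpace E3 X] [IsManifold (𝓡 3) ((⊤ : ℕ∞) : WithTop ℕ∞) X] [ConnectedSpace X] {D : InitialDataSet (𝓡 3) X} (𝒟 : CauchyDevelopment D) (N : ℕ) (M a : Fin N → ℝ), (∀ j, 0 < M j) → (∀ j, |a j| ≤ M j) → ∀ (O' : Set 𝒟.carrier) (mo : Fin N → lorentzGroup × E4) (τ₀ : ℝ) (Ψ : ∀ i, boostedKerrExterior (mo i).1 (mo i).2 (M i) (a i) → 𝒟.carrier) (ρ : Fin N → ℝ → ℝ) (U₀ : TopologicalSpace.Opens E4) (Φ : U₀ → 𝒟.carrier) (R : Fin N → ℝ → ℝ), O' = Summit.FinalStateConjecture.exteriorOf 𝒟 (Φ '' (Minkowski.backgroundOn U₀).lateRegion τ₀ ∪ ⋃ i, Ψ i '' (boostedKerrBackground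 (mo i).1 (mo i).2 (M i) (a i)).lateRegion τ₀) → (∀ i, 𝒟.toSpacetime.IsLateChart (boostedKerrBackground (mo i).1 (mo i).2 (M i) (a i)) O' τ₀ (Ψ i)) → (∀ r : ℝ, ∃ τ₁ : ℝ, Pairwise (Function.onFun Disjoint fun i ↦ Ψ i '' (boostedKerrBackground (mo i).1 (mo i).2 (M i) (a i)).truncLateRegion τ₁ r)) → (∀ i, Tendsto (fun t ↦ ρ i t / t) atTop (𝓝 0)) → {x : E4 | τ₀ < x 0 ∧ ∀ i, ρ i (x 0) < Kerr.radius (a i) (poincareInv (mo i).1 (mo i).2 x)} ⊆ (U₀ : Set E4) → 𝒟.toSpacetime.IsLateChart (Minkowski.backgroundOn U₀) O' τ₀ Φ → Tendsto (fun τ ↦ 𝒟.toSpacetime.deviationCk (Minkowski.backgroundOn U₀) Φ 2 τ) atTop (𝓝 0) → (∀ i, Tendsto (R i) atTop atTop) → (∀ i, Tendsto (fun τ ↦ 𝒟.toSpacetime.truncDeviationCk (boostedKerrBackground (mo i).1 (mo i).2 (M i) (a i)) (Ψ i) 2 (R i τ) τ) atTop (𝓝 0)) → (∀ τ₁ : ℝ,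 τ₀ ≤ τ₁ → O' \ (Φ '' (Minkowski.backgroundOn U₀).lateRegion τ₁ ∪ ⋃ i, Ψ i '' {x | τ₁ < (boostedKerrBackground (mo i).1 (mo i).2 (M i) (a i)).time x.1 ∧ (boostedKerrBackground (mo i).1 (mo i).2 (M i) (a i)).radius x.1 ≤ R i ((boostedKerrBackground (mo i).1 (mo i).2 (M i) (a i)).time x.1)}) ⊆ 𝒟.metric.causalPast 𝒟.timeOrientation (Φ '' (Minkowski.backgroundOn U₀).timeSlab τ₁ ∪ ⋃ i, Ψ i '' (boostedKerrBackground (mo i).1 (mo i).2 (M i) (a i)).truncTimeSlab (R i τ₁) τ₁)) → (∀ i (r : ℝ), ∀ᶠ τ in atTop, ∀ x ∈ (boostedKerrBackground (mo i).1 (mo i).2 (M i) (a i)).truncTimeSlab r τ, 𝒟.toSpacetime.timeOrientation.IsFutureDirected (mfderiv 𝓘(ℝ, E4) (𝓡 4) (Ψ i) x (((mo i).1 : E4 ≃L[ℝ] E4) (Kerr.timeVector (M i) (a i) (poincareInv (mo i).1 (mo i).2 (x : E4)))))) → (∀ᶠ τ in atTop, ∀ x ∈ (Minkowski.backgroundOn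 U₀).timeSlab τ, 𝒟.toSpacetime.timeOrientation.IsFutureDirected (mfderiv 𝓘(ℝ, E4) (𝓡 4) Φ x (E4.basisVector 0))) → ∃ d : FinalStateDecomposition 𝒟.toSpacetime O' 2, d.N = N ∧ (∀ (i : Fin d.N) (j : Fin N), (i : ℕ) = (j : ℕ) → d.mass i = M j ∧ d.spin i = a j) ∧ O' = Summit.FinalStateConjecture.exteriorOf 𝒟 d.charted ∧ Summit.FinalStateConjecture.HasExhaustiveCharts d ∧ Summit.FinalStateConjecture.IsFutureOriented d := by
  intro X _ _ _ _ D 𝒟 N M a hM ha O' mo τ₀ Ψ ρ U₀ Φ R h1 h2 h3 h4 h5 h6 h7 h8 h9 h10 h11 h12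
  obtain ⟨R', h8', h9', h10'⟩ := lateCharts_honestRadii 𝒟 N M a O' mo τ₀ Ψ U₀ Φ R h8 h9 h10
  exact decomposition_of_unorientedLateCharts 𝒟 N M a hM ha O' mo τ₀ Ψ ρ U₀ Φ R' h1 h2 h3 h4 h5 h6 h7
    h8' h9' h10' h11 h12

/-- **The registered gluing stub follows from its floor-free form.** `stub_lateChartsOfSharpChain` (crux
`DriftCapture`, line `registered`, skeleton v6/v7: ONE sharpening pinned chain ⇒ late charts with the
twelve packaging clauses) is implied VERBATIM by the same statement with the honest-radius floor
`∀ τ, max (Kerr.rPlus (M i) (a i)) 0 + 1 ≤ R i τ` deleted from clause 8 of its conclusion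
(`lateCharts_honestRadii`): the gluing may read its radii straight off the windows' `Rₙ → ∞`.
Dafermos–Luk arXiv:1710.01722, Conjecture 1 (b)–(c). [folklore] -/
theorem lateChartsOfSharpChain_of_unfloored : (∀ (N : ℕ) (m₀ χ : ℝ), 0 < N → m₀ ≤ 1 → 0 < m₀ → 0 ≤ χ → χ < 1 → ∀ (X : Type) [TopologicalSpace X] [ChartedSpace E3 X] [IsManifold (𝓡 3) ((⊤ : ℕ∞) : WithTop ℕ∞) X] [T2Space X] [SecondCountableTopology X] [ConnectedSpace X], ∀ D ∈ admissibleVacuumData X, ∀ 𝒟 : VacuumCauchyDevelopment D, 𝒟.IsMaximal → Summit.FinalStateConjecture.HasCompleteNullInfinity 𝒟.toCauchyDevelopment → ∀ (M a : Fin N → ℝ) (Λ : Fin N → lorentzGroup), (∀ j, m₀ ≤ M j ∧ M j ≤ m₀⁻¹ ∧ |a j| ≤ χ * M j) → (∃ (ε : ℕ → ENNReal) (R : ℕ → ℝ) (O : Set 𝒟.carrier) (c : ∀ n : ℕ, ApproximateKerrConfiguration 𝒟.toSpacetime O 2 (ε n) 0 1 (R n)), Tendsto ε atTop (𝓝 0)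 ∧ Tendsto R atTop atTop ∧ (∀ n, (c n).N = N) ∧ (∀ n (i : Fin (c n).N), m₀ ≤ (c n).mass i ∧ (c n).mass i ≤ m₀⁻¹ ∧ |(c n).spin i| ≤ χ * (c n).mass i) ∧ (∀ n, (c (n + 1)).certifiedSlab 0 ⊆ (c n).windowImage) ∧ (∀ K : Set 𝒟.carrier, IsCompact K → ∃ n₀ : ℕ, ∀ n, n₀ ≤ n → Disjoint (c n).windowImage (𝒟.metric.causalPast 𝒟.timeOrientation K)) ∧ O = 𝒟.toCauchyDevelopment.exteriorOf (⋃ n, (c n).windowImage) ∧ O ⊆ 𝒟.metric.causalPast 𝒟.timeOrientation ((c 0).certifiedSlab 0) ∪ ⋃ n, (c n).windowImage ∧ ∀ δ : ℝ, 0 < δ → ∃ n₀ : ℕ, ∀ n, n₀ ≤ n → ∀ (i : Fin (c n).N) (j : Fin N), (i : ℕ) = (j : ℕ) → |(c n).mass i - M j| ≤ δ ∧ |(c n).spin i - a j| ≤ δ ∧ ‖((((c n).motion i).1 : E4 ≃L[ℝ] E4) : E4 →L[ℝ] E4) - (((Λ j : E4 ≃L[ℝ] E4)) : E4 →L[ℝ]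 E4)‖ ≤ δ) → ∃ (O' : Set 𝒟.carrier) (mo : Fin N → lorentzGroup × E4) (τ₀ : ℝ) (Ψ : ∀ i, boostedKerrExterior (mo i).1 (mo i).2 (M i) (a i) → 𝒟.carrier) (ρ : Fin N → ℝ → ℝ) (U₀ : TopologicalSpace.Opens E4) (Φ : U₀ → 𝒟.carrier) (R : Fin N → ℝ → ℝ), O' = Summit.FinalStateConjecture.exteriorOf 𝒟.toCauchyDevelopment (Φ '' (Minkowski.backgroundOn U₀).lateRegion τ₀ ∪ ⋃ i, Ψ i '' (boostedKerrBackground (mo i).1 (mo i).2 (M i) (a i)).lateRegion τ₀) ∧ (∀ i, 𝒟.toSpacetime.IsLateChart (boostedKerrBackground (mo i).1 (mo i).2 (M i) (a i)) O' τ₀ (Ψ i)) ∧ (∀ r : ℝ, ∃ τ₁ : ℝ, Pairwise (Function.onFun Disjoint fun i ↦ Ψ i '' (boostedKerrBackground (mo i).1 (mo i).2 (M i) (a i)).truncLateRegion τ₁ r)) ∧ (∀ i, Tendsto (fun t ↦ ρ i t / t) atTop (𝓝 0)) ∧ {x : E4 | τ₀ < x 0 ∧ ∀ i, ρ i (x 0)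 < Kerr.radius (a i) (poincareInv (mo i).1 (mo i).2 x)} ⊆ (U₀ : Set E4) ∧ 𝒟.toSpacetime.IsLateChart (Minkowski.backgroundOn U₀) O' τ₀ Φ ∧ Tendsto (fun τ ↦ 𝒟.toSpacetime.deviationCk (Minkowski.backgroundOn U₀) Φ 2 τ) atTop (𝓝 0) ∧ (∀ i, Tendsto (R i) atTop atTop) ∧ (∀ i, Tendsto (fun τ ↦ 𝒟.toSpacetime.truncDeviationCk (boostedKerrBackground (mo i).1 (mo i).2 (M i) (a i)) (Ψ i) 2 (R i τ) τ) atTop (𝓝 0)) ∧ (∀ τ₁ : ℝ, τ₀ ≤ τ₁ → O' \ (Φ '' (Minkowski.backgroundOn U₀).lateRegion τ₁ ∪ ⋃ i, Ψ i '' {x | τ₁ < (boostedKerrBackground (mo i).1 (mo i).2 (M i) (a i)).time x.1 ∧ (boostedKerrBackground (mo i).1 (mo i).2 (M i) (a i)).radius x.1 ≤ R i ((boostedKerrBackground (mo i).1 (mo i).2 (M i) (a i)).time x.1)}) ⊆ 𝒟.metric.causalPast 𝒟.timeOrientation (Φ '' (Minkowski.backgroundOn U₀).timeSlab τ₁ ∪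 ⋃ i, Ψ i '' (boostedKerrBackground (mo i).1 (mo i).2 (M i) (a i)).truncTimeSlab (R i τ₁) τ₁)) ∧ (∀ i (r : ℝ), ∀ᶠ τ in atTop, ∀ x ∈ (boostedKerrBackground (mo i).1 (mo i).2 (M i) (a i)).truncTimeSlab r τ, 𝒟.toSpacetime.timeOrientation.IsFutureDirected (mfderiv 𝓘(ℝ, E4) (𝓡 4) (Ψ i) x (((mo i).1 : E4 ≃L[ℝ] E4) (Kerr.timeVector (M i) (a i) (poincareInv (mo i).1 (mo i).2 (x : E4)))))) ∧ ∀ᶠ τ in atTop, ∀ x ∈ (Minkowski.backgroundOn U₀).timeSlab τ, 𝒟.toSpacetime.timeOrientation.IsFutureDirected (mfderiv 𝓘(ℝ, E4) (𝓡 4) Φ x (E4.basisVector 0))) → ∀ (N : ℕ) (m₀ χ : ℝ), 0 < N → m₀ ≤ 1 → 0 < m₀ → 0 ≤ χ → χ < 1 → ∀ (X : Type) [TopologicalSpace X] [ChartedSpace E3 X] [IsManifold (𝓡 3) ((⊤ : ℕ∞) : WithTop ℕ∞) X] [T2Space X] [SecondCountableTopology X] [ConnectedSpace X], ∀ D ∈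 admissibleVacuumData X, ∀ 𝒟 : VacuumCauchyDevelopment D, 𝒟.IsMaximal → Summit.FinalStateConjecture.HasCompleteNullInfinity 𝒟.toCauchyDevelopment → ∀ (M a : Fin N → ℝ) (Λ : Fin N → lorentzGroup), (∀ j, m₀ ≤ M j ∧ M j ≤ m₀⁻¹ ∧ |a j| ≤ χ * M j) → (∃ (ε : ℕ → ENNReal) (R : ℕ → ℝ) (O : Set 𝒟.carrier) (c : ∀ n : ℕ, ApproximateKerrConfiguration 𝒟.toSpacetime O 2 (ε n) 0 1 (R n)), Tendsto ε atTop (𝓝 0) ∧ Tendsto R atTop atTop ∧ (∀ n, (c n).N = N) ∧ (∀ n (i : Fin (c n).N), m₀ ≤ (c n).mass i ∧ (c n).mass i ≤ m₀⁻¹ ∧ |(c n).spin i| ≤ χ * (c n).mass i) ∧ (∀ n, (c (n + 1)).certifiedSlab 0 ⊆ (c n).windowImage) ∧ (∀ K : Set 𝒟.carrier, IsCompact K → ∃ n₀ : ℕ, ∀ n, n₀ ≤ n → Disjoint (c n).windowImage (𝒟.metric.causalPast 𝒟.timeOrientation K)) ∧ O = 𝒟.toCauchyDevelopment.exteriorOf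 (⋃ n, (c n).windowImage) ∧ O ⊆ 𝒟.metric.causalPast 𝒟.timeOrientation ((c 0).certifiedSlab 0) ∪ ⋃ n, (c n).windowImage ∧ ∀ δ : ℝ, 0 < δ → ∃ n₀ : ℕ, ∀ n, n₀ ≤ n → ∀ (i : Fin (c n).N) (j : Fin N), (i : ℕ) = (j : ℕ) → |(c n).mass i - M j| ≤ δ ∧ |(c n).spin i - a j| ≤ δ ∧ ‖((((c n).motion i).1 : E4 ≃L[ℝ] E4) : E4 →L[ℝ] E4) - (((Λ j : E4 ≃L[ℝ] E4)) : E4 →L[ℝ] E4)‖ ≤ δ) → ∃ (O' : Set 𝒟.carrier) (mo : Fin N → lorentzGroup × E4) (τ₀ : ℝ) (Ψ : ∀ i, boostedKerrExterior (mo i).1 (mo i).2 (M i) (a i) → 𝒟.carrier) (ρ : Fin N → ℝ → ℝ) (U₀ : TopologicalSpace.Opens E4) (Φ : U₀ → 𝒟.carrier) (R : Fin N → ℝ → ℝ), O' = Summit.FinalStateConjecture.exteriorOf 𝒟.toCauchyDevelopment (Φ '' (Minkowski.backgroundOn U₀).lateRegion τ₀ ∪ ⋃ i, Ψ i '' (boostedKerrBackground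 (mo i).1 (mo i).2 (M i) (a i)).lateRegion τ₀) ∧ (∀ i, 𝒟.toSpacetime.IsLateChart (boostedKerrBackground (mo i).1 (mo i).2 (M i) (a i)) O' τ₀ (Ψ i)) ∧ (∀ r : ℝ, ∃ τ₁ : ℝ, Pairwise (Function.onFun Disjoint fun i ↦ Ψ i '' (boostedKerrBackground (mo i).1 (mo i).2 (M i) (a i)).truncLateRegion τ₁ r)) ∧ (∀ i, Tendsto (fun t ↦ ρ i t / t) atTop (𝓝 0)) ∧ {x : E4 | τ₀ < x 0 ∧ ∀ i, ρ i (x 0) < Kerr.radius (a i) (poincareInv (mo i).1 (mo i).2 x)} ⊆ (U₀ : Set E4) ∧ 𝒟.toSpacetime.IsLateChart (Minkowski.backgroundOn U₀) O' τ₀ Φ ∧ Tendsto (fun τ ↦ 𝒟.toSpacetime.deviationCk (Minkowski.backgroundOn U₀) Φ 2 τ) atTop (𝓝 0) ∧ (∀ i, Tendsto (R i) atTop atTop ∧ ∀ τ, max (Kerr.rPlus (M i) (a i)) 0 + 1 ≤ R i τ) ∧ (∀ i, Tendsto (fun τ ↦ 𝒟.toSpacetime.truncDeviationCk (boostedKerrBackground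 (mo i).1 (mo i).2 (M i) (a i)) (Ψ i) 2 (R i τ) τ) atTop (𝓝 0)) ∧ (∀ τ₁ : ℝ, τ₀ ≤ τ₁ → O' \ (Φ '' (Minkowski.backgroundOn U₀).lateRegion τ₁ ∪ ⋃ i, Ψ i '' {x | τ₁ < (boostedKerrBackground (mo i).1 (mo i).2 (M i) (a i)).time x.1 ∧ (boostedKerrBackground (mo i).1 (mo i).2 (M i) (a i)).radius x.1 ≤ R i ((boostedKerrBackground (mo i).1 (mo i).2 (M i) (a i)).time x.1)}) ⊆ 𝒟.metric.causalPast 𝒟.timeOrientation (Φ '' (Minkowski.backgroundOn U₀).timeSlab τ₁ ∪ ⋃ i, Ψ i '' (boostedKerrBackground (mo i).1 (mo i).2 (M i) (a i)).truncTimeSlab (R i τ₁) τ₁)) ∧ (∀ i (r : ℝ), ∀ᶠ τ in atTop, ∀ x ∈ (boostedKerrBackground (mo i).1 (mo i).2 (M i) (a i)).truncTimeSlab r τ, 𝒟.toSpacetime.timeOrientation.IsFutureDirected (mfderiv 𝓘(ℝ, E4) (𝓡 4) (Ψ i) x (((mo i).1 : E4 ≃L[ℝ] E4) (Kerr.timeVector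 (M i) (a i) (poincareInv (mo i).1 (mo i).2 (x : E4)))))) ∧ ∀ᶠ τ in atTop, ∀ x ∈ (Minkowski.backgroundOn U₀).timeSlab τ, 𝒟.toSpacetime.timeOrientation.IsFutureDirected (mfderiv 𝓘(ℝ, E4) (𝓡 4) Φ x (E4.basisVector 0)) := by
  intro h N m₀ χ hN hm₁ hm₀ hχ₀ hχ₁ X _ _ _ _ _ _ D hD 𝒟 hmax hscri M a Λ hbox hchain
  obtain ⟨O', mo, τ₀, Ψ, ρ, U₀, Φ, R, h1, h2, h3, h4, h5, h6, h7, h8, h9, h10, h11, h12⟩ :=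
    h N m₀ χ hN hm₁ hm₀ hχ₀ hχ₁ X D hD 𝒟 hmax hscri M a Λ hbox hchain
  obtain ⟨R', h8', h9', h10'⟩ :=
    lateCharts_honestRadii 𝒟.toCauchyDevelopment N M a O' mo τ₀ Ψ U₀ Φ R h8 h9 h10
  exact ⟨O', mo, τ₀, Ψ, ρ, U₀, Φ, R', h1, h2, h3, h4, h5, h6, h7, h8', h9', h10', h11, h12⟩

end Summit.FinalStateConjecture.FinalStateConjecture.Theorems.RenormalisedDrift.DriftCapture

end
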